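import Mathlib

/-!
# R90 · S6 «Ch. 14.1–14.5 stable trace formula» — WAVE 2 helper W2-a: polynomial density on a real chart

Supply for the `dense` field of `R90.S6.HeckeVariation` (`Cruxes/H413/Lines/R90_S6_StableTFSpectralB.lean`
§E1, AUDIT S6#B Q4): the Satake chart is taken in the `t = z + z⁻¹` coordinate, so the compact parameter
set `X ⊂ ℂ` of the unitary unramified spectrum lies in `ℝ ⊂ ℂ`, and the Satake transforms of the
spherical Hecke algebra are (all) the polynomials in `t`.  This file proves the analysis half: on a
compact `X ⊂ ℂ` contained in the real line, the complex polynomial functions are sup-norm dense in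
`C(X, ℂ)` — for every `g ∈ C(X, ℂ)` and `ε > 0` there is `p ∈ ℂ[t]` with `‖p|_X − g‖ < ε`.
PROOF: complex Stone–Weierstrass (`ContinuousMap.starSubalgebra_topologicalClosure_eq_top_of_separatesPoints`)
for the star subalgebra whose carrier is `polynomialFunctions X`; it is self-adjoint because on a REAL
chart `star (p|_X) = (p.map conj)|_X` (`conj x = x` for `x ∈ X`), and it separates points
(`polynomialFunctions_separatesPoints`).  (On a compact subset of ℂ NOT contained in a line the statement
is false in general — e.g. on an arc of the unit circle `z ↦ z̄` is not a uniform limit of polynomials —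
which is why the chart is the real `t`-coordinate, AUDIT S6#B Q4.)

THE PRINT (J. D. Rogawski, *Automorphic Representations of Unitary Groups in Three Variables*,
Ann. of Math. Stud. 123 (1990)), §10.3 p. 159 (proof of Thm. 10.3.1): «z_j lies either on the unit
circle or in a compact sub-interval of ℝ … Let C be the algebra of continuous functions on X.  The sum
(10.3.6) … extends to a linear functional on C» — the extension to `C` is along the density of the Satake
image (Weierstrass).

Cell `hodgecm-mathlib`, crux H413 (`stmt-HodgeConjecture-24833`), route of record `HCCMUnconditional`;
programme R90-TF (brief `director/R90-BRIEF.v2.md`), section S6 (base `R90-C14`), seat R90-C14-p03 (g0),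
RE-DEAL 15:49:51Z (W2-a, signature = the planner text verbatim, boxed on `W2a_signature.v1.lean`).
Lane `--supports stmt-HodgeConjecture-24833 --as helper`; ONE public theorem (one private lemma), pure
Mathlib, no definition, no kit, no posited object, no `sorry`.
HONEST LABEL: this file proves no printed global statement; HC_CM is proved only modulo the 7 printed
citations (2 remaining named inputs: hLiu418 = stmt-HodgeConjecture-24832, h413 = stmt-HodgeConjecture-24833)
until rung 0 closes.
-/

set_option autoImplicit false
-- the mandated namespace repeats the single-problem summit's segment (`HodgeConjecture.HodgeConjecture`)
set_option linter.dupNamespace false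

open Polynomial

namespace Summit.HodgeConjecture.HodgeConjecture.R90.S6

/-- Complex Weierstrass on a compact real chart: for `s ⊆ ℝ ⊂ ℂ` compact, every `g ∈ C(s, ℂ)` is
within `ε` of a complex polynomial function in the sup norm. -/
private theorem exists_polynomial_near_of_subset_range_ofReal (s : Set ℂ) [CompactSpace s]
    (hs : s ⊆ Set.range ((↑) : ℝ → ℂ)) (g : C(s, ℂ)) {ε : ℝ} (hε : 0 < ε) :
    ∃ p : Polynomial ℂ, ‖p.toContinuousMapOn s - g‖ < ε := by
  -- the polynomial functions on a real chart form a star subalgebra of `C(s, ℂ)`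
  let A : StarSubalgebra ℂ C(s, ℂ) :=
    { polynomialFunctions s with
      star_mem' := fun {f} hf => by
        change f ∈ polynomialFunctions s at hf
        change star f ∈ polynomialFunctions s
        rw [← SetLike.mem_coe, polynomialFunctions_coe] at hf ⊢
        obtain ⟨p, rfl⟩ := hf
        refine ⟨p.map (starRingEnd ℂ), ?_⟩
        ext x
        obtain ⟨r, hr⟩ := hs x.2
        simp only [Polynomial.toContinuousMapOnAlgHom_apply, Polynomial.toContinuousMapOn_apply,
          Polynomial.toContinuousMap_apply, ContinuousMap.star_apply]
        rw [← hr, Polynomial.eval_map]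
        conv_lhs => rw [← Complex.conj_ofReal r]
        rw [Polynomial.eval₂_hom, starRingEnd_apply] }
  -- it separates points, hence is dense (complex Stone–Weierstrass)
  have hA : A.SeparatesPoints := polynomialFunctions_separatesPoints s
  have htop : A.topologicalClosure = ⊤ :=
    ContinuousMap.starSubalgebra_topologicalClosure_eq_top_of_separatesPoints A hA
  have hg : g ∈ closure (A : Set C(s, ℂ)) := by
    rw [← StarSubalgebra.topologicalClosure_coe, SetLike.mem_coe, htop]
    exact StarSubalgebra.mem_top
  -- extract an `ε`-approximant and read it as a polynomial
  obtain ⟨b, hb, hgb⟩ := Metric.mem_closure_iff.mp hg ε hε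
  have hb' : b ∈ (polynomialFunctions s : Set C(s, ℂ)) := hb
  rw [polynomialFunctions_coe] at hb'
  obtain ⟨p, rfl⟩ := hb'
  refine ⟨p, ?_⟩
  rwa [dist_comm, dist_eq_norm, Polynomial.toContinuousMapOnAlgHom_apply] at hgb

/-- **(W2-a) Polynomial density on a real chart** [Rogawski1990, §10.3 p. 159, proof of Thm. 10.3.1:
«z_j lies either on the unit circle or in a compact sub-interval of ℝ … Let C be the algebra of continuous
functions on X … (10.3.6) extends to a linear functional on C»]: for a compact `X ⊂ ℂ` contained in the
real line (the `t = z + z⁻¹` chart of the unitary unramified spectrum) the complex polynomial functions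
`t ↦ p(t)`, `p ∈ ℂ[t]`, are dense in `C(X, ℂ)` for the sup norm: every `g ∈ C(X, ℂ)` is within any
`ε > 0` of some `p|_X`.  With the Satake isomorphism (the spherical Hecke algebra maps ONTO `ℂ[t]`) this is
exactly the `dense` field of `R90.S6.HeckeVariation` for the chart `ev φ := (Satake φ).toContinuousMapOn X`.
Complex Stone–Weierstrass for the self-adjoint (real chart!) point-separating algebra of polynomial functions.
(print: Rogawski1990, §10.3 p. 159) -/
theorem polyDense_realChart (X : TopologicalSpace.Compacts ℂ) (hX : (X : Set ℂ) ⊆ Set.range ((↑) : ℝ → ℂ)) :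
    ∀ g : C(X, ℂ), ∀ ε : ℝ, 0 < ε →
      ∃ p : Polynomial ℂ, ‖(p.toContinuousMapOn (X : Set ℂ) : C(X, ℂ)) - g‖ < ε := by
  intro g ε hε
  haveI : CompactSpace (X : Set ℂ) := isCompact_iff_compactSpace.mp X.isCompact
  exact exists_polynomial_near_of_subset_range_ofReal (X : Set ℂ) hX g hε

end Summit.HodgeConjecture.HodgeConjecture.R90.S6
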